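import Summits.BirchSwinnertonDyer.BirchSwinnertonDyer.Theorems.ClassRecordThreeEulerHalvesAtThreeCartanSupplyCharacterSums
import HarnessLib

/-!
# SUPPLY, the NORM-ONE count `Σ_g χ_W(g)² = |GL₂(𝔽_q)|`, part 1: conjugacy in `GL₂(𝔽_q)` without class enumeration

Helper file `--supports stmt-BirchSwinnertonDyer-19109 --as helper` (seat `bsd-idea-10` g13; crux `EulerHalvesAtThree` ∕ child 23422 line `cartan` v11,
stub SUPPLY; LEAD memo `HOME/tam3-p1/g23/SUPPLY-ROAD-GG1.md` §1 CONSEQUENCE: «⟨χ_W, χ_W⟩ = 1 is a uniform counting identity», the hypothesis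
`CubicNewvectorCharNormOne` of `cartanTorusLatticeSupply_of_virtual`). The count is organised WITHOUT enumerating conjugacy classes and without `ℙ¹`:
for a finite set `S ⊆ G` and a class function `F`,
  `Σ_g F(g)·#{y : y⁻¹gy ∈ S} = |G|·Σ_{x ∈ S} F(x)`   and   `#{y : y⁻¹gy ∈ S} = |C_G(g)|·#{x ∈ S : x ~ g}`,
applied later (parts 2–3) to the split torus `T_s` and a non-split torus `T_C`. THIS FILE (all PROVED, `q` any prime):
* §1 `2 × 2` Cayley–Hamilton, the companion matrix `comp t d`, the cyclic matrix `[v | Mv]`, and `M·[v|Mv] = [v|Mv]·comp(tr M, det M)`;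
  a non-scalar matrix has a cyclic vector (`exists_det_cycMat_ne_zero`), hence is conjugate to its companion matrix (`conj_comp`);
* §2 **`exists_conj`**: two NON-SCALAR matrices with the same trace and determinant are conjugate under `GL₂(𝔽_q)`; the criterion
  `conj_iff` for group elements (`x ~ g ⟺ x non-scalar ∧ tr x = tr g ∧ det x = det g`, `g` non-scalar);
* §3 transporters: `#{y : y⁻¹gy = x} = #{y : y⁻¹gy = g}` for `x ~ g` (`card_transporter`), conjugate elements have equinumerous centralisers
  (`card_centralizer_conj`), and the FIBRE FORMULA `card_conj_mem`: `#{y : y⁻¹gy ∈ S} = #{y : y⁻¹gy = g} · #{x ∈ S : x ~ g}`;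
* §4 the DOUBLE COUNT `sum_mul_card_conj_mem`: `Σ_g F(g)·#{y : y⁻¹gy ∈ S} = |G|·Σ_{x∈S} F(x)` (any finite group, any finite `S`, `F` a class function);
* §5 centraliser sizes: all of `G` for scalar `g`; the split torus for a regular diagonal element (`(q−1)²`); the non-split torus
  `nonsplitTorus g` for `g` without rational eigenvalue (`q² − 1`, tree `nonsplitTorus_card`).
HONEST FRAMING: finite group ∕ finite-field bookkeeping only; NORM ONE itself is parts 2–4; nothing about NUM, crux 23422 ∕ 19109 or any summit statement
is proved by this seat; BSD is proved for no curve. [folklore]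
-/

set_option linter.dupNamespace false
set_option autoImplicit false

noncomputable section

namespace Summit.BirchSwinnertonDyer.BirchSwinnertonDyer.Theorems.CartanSupply.NormOne

open Summit.BirchSwinnertonDyer.BirchSwinnertonDyer.Theorems.CartanDegree
open Summit.BirchSwinnertonDyer.BirchSwinnertonDyer.Theorems.CartanTorusCubeCut
open scoped Classical

variable {q : ℕ} [Fact q.Prime]

/-! ## §1 Cayley–Hamilton, companion and cyclic matrices -/

/-- PROVED: `2 × 2` Cayley–Hamilton, `M² = tr M·M − det M·1`. [folklore] -/
theorem mul_self_eq (M : Mat q) : M * M = M.trace • M - M.det • (1 : Mat q) := by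
  ext i j
  fin_cases i <;> fin_cases j <;>
    simp [Matrix.mul_apply, Fin.sum_univ_two, Matrix.trace_fin_two, Matrix.det_fin_two] <;> ring

/-- the companion matrix of `x² − t·x + d`. -/
def comp (t d : ZMod q) : Mat q := !![0, -d; 1, t]

/-- PROVED: `tr comp(t,d) = t`. [folklore] -/
theorem trace_comp (t d : ZMod q) : (comp t d : Mat q).trace = t := by
  simp [comp, Matrix.trace_fin_two]

/-- PROVED: `det comp(t,d) = d`. [folklore] -/
theorem det_comp (t d : ZMod q) : (comp t d : Mat q).det = d := by
  simp [comp, Matrix.det_fin_two]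

/-- the cyclic matrix `[v | Mv]`. -/
def cycMat (M : Mat q) (v : Fin 2 → ZMod q) : Mat q := Matrix.of fun i j => if j = 0 then v i else M.mulVec v i

/-- PROVED: `det [v | Mv] = v₀ (Mv)₁ − v₁ (Mv)₀`. [folklore] -/
theorem det_cycMat (M : Mat q) (v : Fin 2 → ZMod q) : (cycMat M v).det = v 0 * M.mulVec v 1 - v 1 * M.mulVec v 0 := by
  rw [Matrix.det_fin_two]
  simp [cycMat]
  ring

/-- PROVED: `M·[v | Mv] = [v | Mv]·comp(tr M, det M)` (second column by Cayley–Hamilton). [folklore] -/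
theorem mul_cycMat (M : Mat q) (v : Fin 2 → ZMod q) : M * cycMat M v = cycMat M v * comp M.trace M.det := by
  ext i j
  fin_cases i <;> fin_cases j <;>
    simp [cycMat, comp, Matrix.mul_apply, Fin.sum_univ_two, Matrix.mulVec, dotProduct, Matrix.trace_fin_two, Matrix.det_fin_two] <;> ring

/-- PROVED: a NON-SCALAR matrix has a cyclic vector: some `[v | Mv]` is invertible. [folklore] -/
theorem exists_det_cycMat_ne_zero (M : Mat q) (hM : ¬ IsScalarMat M) : ∃ v : Fin 2 → ZMod q, (cycMat M v).det ≠ 0 := by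
  by_cases h10 : M 1 0 = 0
  · by_cases h01 : M 0 1 = 0
    · have hne : M 0 0 ≠ M 1 1 := fun h => hM ⟨h01, h10, h⟩
      refine ⟨![1, 1], ?_⟩
      rw [det_cycMat]
      simp [Matrix.mulVec, dotProduct, Fin.sum_univ_two, h10, h01]
      exact sub_ne_zero.2 (Ne.symm hne)
    · refine ⟨![0, 1], ?_⟩
      rw [det_cycMat]
      simpa [Matrix.mulVec, dotProduct, Fin.sum_univ_two] using h01
  · refine ⟨![1, 0], ?_⟩
    rw [det_cycMat]
    simpa [Matrix.mulVec, dotProduct, Fin.sum_univ_two] using h10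

/-- PROVED: a non-scalar matrix is conjugate to its companion matrix: `P⁻¹ M P = comp(tr M, det M)` for some `P ∈ GL₂(𝔽_q)`. [folklore] -/
theorem conj_comp (M : Mat q) (hM : ¬ IsScalarMat M) :
    ∃ P : G q, ((P⁻¹ : G q) : Mat q) * M * (P : Mat q) = comp M.trace M.det := by
  obtain ⟨v, hv⟩ := exists_det_cycMat_ne_zero M hM
  refine ⟨Matrix.GeneralLinearGroup.mkOfDetNeZero _ hv, ?_⟩
  have hP : ((Matrix.GeneralLinearGroup.mkOfDetNeZero _ hv : G q) : Mat q) = cycMat M v := rfl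
  rw [Matrix.coe_units_inv, hP, mul_assoc, mul_cycMat, ← mul_assoc, Matrix.nonsing_inv_mul _ (Ne.isUnit hv), one_mul]

/-! ## §2 Non-scalar matrices with equal trace and determinant are conjugate -/

/-- PROVED — **CONJUGACY BY TRACE AND DETERMINANT**: non-scalar `M, M'` with `tr M' = tr M`, `det M' = det M` satisfy `y⁻¹ M y = M'`
for some `y ∈ GL₂(𝔽_q)`. [folklore] -/
theorem exists_conj (M M' : Mat q) (hM : ¬ IsScalarMat M) (hM' : ¬ IsScalarMat M') (ht : M'.trace = M.trace) (hd : M'.det = M.det) :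
    ∃ y : G q, ((y⁻¹ : G q) : Mat q) * M * (y : Mat q) = M' := by
  obtain ⟨P, hP⟩ := conj_comp M hM
  obtain ⟨P', hP'⟩ := conj_comp M' hM'
  rw [ht, hd, ← hP] at hP'
  refine ⟨P * P'⁻¹, ?_⟩
  rw [mul_inv_rev, inv_inv, Units.val_mul, Units.val_mul]
  calc (P' : Mat q) * ((P⁻¹ : G q) : Mat q) * M * ((P : Mat q) * ((P'⁻¹ : G q) : Mat q))
      = (P' : Mat q) * (((P⁻¹ : G q) : Mat q) * M * (P : Mat q)) * ((P'⁻¹ : G q) : Mat q) := by noncomm_ring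
    _ = (P' : Mat q) * (((P'⁻¹ : G q) : Mat q) * M' * (P' : Mat q)) * ((P'⁻¹ : G q) : Mat q) := by rw [hP']
    _ = ((P' : Mat q) * ((P'⁻¹ : G q) : Mat q)) * M' * ((P' : Mat q) * ((P'⁻¹ : G q) : Mat q)) := by noncomm_ring
    _ = M' := by rw [Units.mul_inv, one_mul, mul_one]

/-- PROVED: group-level form of `exists_conj`. [folklore] -/
theorem exists_conj_units (g x : G q) (hg : ¬ IsScalarMat (g : Mat q)) (hx : ¬ IsScalarMat (x : Mat q))
    (ht : (x : Mat q).trace = (g : Mat q).trace) (hd : (x : Mat q).det = (g : Mat q).det) : ∃ y : G q, y⁻¹ * g * y = x := by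
  obtain ⟨y, hy⟩ := exists_conj (g : Mat q) (x : Mat q) hg hx ht hd
  exact ⟨y, Units.ext (by simpa only [Units.val_mul] using hy)⟩

/-- PROVED: conjugation preserves the trace. [folklore] -/
theorem trace_conj (g y : G q) : ((y⁻¹ * g * y : G q) : Mat q).trace = (g : Mat q).trace := by
  rw [Units.val_mul, Units.val_mul]
  exact Matrix.trace_units_conj' y (g : Mat q)

omit [Fact q.Prime] in
/-- PROVED: conjugation preserves the determinant. [folklore] -/
theorem det_conj (g y : G q) : ((y⁻¹ * g * y : G q) : Mat q).det = (g : Mat q).det := by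
  rw [Units.val_mul, Units.val_mul]
  exact Matrix.det_units_conj' y (g : Mat q)

omit [Fact q.Prime] in
/-- PROVED: conjugation preserves being scalar. [folklore] -/
theorem isScalarMat_conj (g y : G q) : IsScalarMat ((y⁻¹ * g * y : G q) : Mat q) ↔ IsScalarMat (g : Mat q) := by
  rw [Units.val_mul, Units.val_mul]
  have h := PS.isScalarMat_conj_iff y⁻¹ (g : Mat q)
  rwa [inv_inv] at h

omit [Fact q.Prime] in
/-- PROVED: conjugation preserves having a rational eigenvalue. [folklore] -/
theorem hasRatEigenvalue_conj (g y : G q) : HasRatEigenvalue ((y⁻¹ * g * y : G q) : Mat q) ↔ HasRatEigenvalue (g : Mat q) := by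
  rw [Units.val_mul, Units.val_mul]
  have h := PS.hasRatEigenvalue_conj_iff y⁻¹ (g : Mat q)
  rwa [inv_inv] at h

/-- PROVED: conjugation preserves the discriminant condition `Δ = 0`. [folklore] -/
theorem discr_conj (g y : G q) :
    ((y⁻¹ * g * y : G q) : Mat q).trace ^ 2 - 4 * ((y⁻¹ * g * y : G q) : Mat q).det = (g : Mat q).trace ^ 2 - 4 * (g : Mat q).det := by
  rw [trace_conj, det_conj]

/-- PROVED — **THE CONJUGACY CRITERION** for non-scalar `g`: `x ~ g` iff `x` is non-scalar with the same trace and determinant. [folklore] -/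
theorem conj_iff (g x : G q) (hg : ¬ IsScalarMat (g : Mat q)) :
    (∃ y : G q, y⁻¹ * g * y = x) ↔
      ¬ IsScalarMat (x : Mat q) ∧ (x : Mat q).trace = (g : Mat q).trace ∧ (x : Mat q).det = (g : Mat q).det := by
  constructor
  · rintro ⟨y, rfl⟩
    exact ⟨fun h => hg ((isScalarMat_conj g y).1 h), trace_conj g y, det_conj g y⟩
  · rintro ⟨hx, ht, hd⟩
    exact exists_conj_units g x hg hx ht hd

/-! ## §3 Transporters, centralisers and the fibre formula -/

/-- PROVED: the transporter onto a conjugate is a translate of the centraliser: `#{y : y⁻¹gy = x} = #{y : y⁻¹gy = g}` when `y₀⁻¹gy₀ = x`. [folklore] -/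
theorem card_transporter (g x y₀ : G q) (h : y₀⁻¹ * g * y₀ = x) :
    (Finset.univ.filter fun y : G q => y⁻¹ * g * y = x).card = (Finset.univ.filter fun y : G q => y⁻¹ * g * y = g).card := by
  refine Finset.card_equiv (Equiv.mulRight y₀⁻¹) (fun y => ?_)
  simp only [Finset.mem_filter, Finset.mem_univ, true_and, Equiv.coe_mulRight]
  rw [← h]
  constructor
  · intro e
    calc (y * y₀⁻¹)⁻¹ * g * (y * y₀⁻¹) = y₀ * (y⁻¹ * g * y) * y₀⁻¹ := by group
      _ = y₀ * (y₀⁻¹ * g * y₀) * y₀⁻¹ := by rw [e]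
      _ = g := by group
  · intro e
    calc y⁻¹ * g * y = y₀⁻¹ * ((y * y₀⁻¹)⁻¹ * g * (y * y₀⁻¹)) * y₀ := by group
      _ = y₀⁻¹ * g * y₀ := by rw [e]

/-- PROVED: conjugate elements have equinumerous centralisers. [folklore] -/
theorem card_centralizer_conj (g x z : G q) (h : z⁻¹ * g * z = x) :
    (Finset.univ.filter fun y : G q => y⁻¹ * g * y = g).card = (Finset.univ.filter fun y : G q => y⁻¹ * x * y = x).card := by
  refine Finset.card_equiv ((Equiv.mulLeft z⁻¹).trans (Equiv.mulRight z)) (fun y => ?_)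
  simp only [Finset.mem_filter, Finset.mem_univ, true_and, Equiv.trans_apply, Equiv.coe_mulLeft, Equiv.coe_mulRight]
  rw [← h]
  constructor
  · intro e
    calc (z⁻¹ * y * z)⁻¹ * (z⁻¹ * g * z) * (z⁻¹ * y * z) = z⁻¹ * (y⁻¹ * g * y) * z := by group
      _ = z⁻¹ * g * z := by rw [e]
  · intro e
    calc y⁻¹ * g * y = z * ((z⁻¹ * y * z)⁻¹ * (z⁻¹ * g * z) * (z⁻¹ * y * z)) * z⁻¹ := by group
      _ = z * (z⁻¹ * g * z) * z⁻¹ := by rw [e]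
      _ = g := by group

/-- PROVED — **THE FIBRE FORMULA**: `#{y : y⁻¹gy ∈ S} = #{y : y⁻¹gy = g} · #{x ∈ S : x ~ g}`. [folklore] -/
theorem card_conj_mem (S : Finset (G q)) (g : G q) :
    (Finset.univ.filter fun y : G q => y⁻¹ * g * y ∈ S).card =
      (Finset.univ.filter fun y : G q => y⁻¹ * g * y = g).card * (S.filter fun x => ∃ y : G q, y⁻¹ * g * y = x).card := by
  rw [Finset.card_eq_sum_card_fiberwise (f := fun y : G q => y⁻¹ * g * y) (s := Finset.univ.filter fun y : G q => y⁻¹ * g * y ∈ S)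
      (t := S) (fun y hy => (Finset.mem_filter.1 (Finset.mem_coe.1 hy)).2),
    Finset.card_eq_sum_ones (S.filter _), Finset.sum_filter, Finset.mul_sum]
  refine Finset.sum_congr rfl (fun x hx => ?_)
  have hfilt : ((Finset.univ.filter fun y : G q => y⁻¹ * g * y ∈ S).filter fun y => y⁻¹ * g * y = x) =
      Finset.univ.filter fun y : G q => y⁻¹ * g * y = x := by
    ext y
    simp only [Finset.mem_filter, Finset.mem_univ, true_and]
    exact ⟨fun h => h.2, fun h => ⟨h ▸ hx, h⟩⟩
  rw [hfilt]
  split_ifs with hex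
  · obtain ⟨y₀, hy₀⟩ := hex
    rw [card_transporter g x y₀ hy₀, mul_one]
  · rw [mul_zero, Finset.card_eq_zero, Finset.filter_eq_empty_iff]
    exact fun y _ hy => hex ⟨y, hy⟩

/-! ## §4 The double count -/

/-- PROVED — **THE DOUBLE COUNT**: for a class function `F` on a finite group and any finite set `S` of elements,
`Σ_g F(g)·#{y : y⁻¹gy ∈ S} = |G|·Σ_{x ∈ S} F(x)` (substitute `g = y x y⁻¹`). [folklore] -/
theorem sum_mul_card_conj_mem {Γ : Type*} [Group Γ] [Fintype Γ] [DecidableEq Γ] (S : Finset Γ) (F : Γ → ℤ) (hcl : ∀ a b, F (a * b) = F (b * a)) :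
    ∑ g, F g * ((Finset.univ.filter fun y : Γ => y⁻¹ * g * y ∈ S).card : ℤ) = Fintype.card Γ * ∑ x ∈ S, F x := by
  have h2 : ∑ g, F g * ((Finset.univ.filter fun y : Γ => y⁻¹ * g * y ∈ S).card : ℤ) = ∑ y : Γ, ∑ g : Γ, (if y⁻¹ * g * y ∈ S then F g else 0) := by
    rw [Finset.sum_comm]
    refine Finset.sum_congr rfl (fun g _ => ?_)
    simp only [Finset.card_filter, Nat.cast_sum, Nat.cast_ite, Nat.cast_one, Nat.cast_zero, Finset.mul_sum, mul_boole]
  have h3 : ∀ y : Γ, ∑ g : Γ, (if y⁻¹ * g * y ∈ S then F g else 0) = ∑ x : Γ, (if x ∈ S then F x else 0) := fun y => by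
    refine Fintype.sum_equiv ((Equiv.mulLeft y⁻¹).trans (Equiv.mulRight y)) _ _ (fun g => ?_)
    simp only [Equiv.trans_apply, Equiv.coe_mulLeft, Equiv.coe_mulRight]
    have hc : F (y⁻¹ * g * y) = F g := by rw [hcl, ← mul_assoc, mul_inv_cancel, one_mul]
    rw [hc]
  have h4 : ∑ x : Γ, (if x ∈ S then F x else 0) = ∑ x ∈ S, F x := by
    rw [← Finset.sum_filter]
    congr 1
    ext x
    simp
  rw [h2]
  simp only [h3, h4, Finset.sum_const, Finset.card_univ, nsmul_eq_mul]

/-! ## §5 Centraliser sizes -/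

/-- PROVED: a scalar element is central: `y⁻¹ g y = g`. [folklore] -/
theorem conj_of_isScalar (g y : G q) (hs : IsScalarMat (g : Mat q)) : y⁻¹ * g * y = g := by
  obtain ⟨c, hc⟩ := (PS.isScalarMat_iff_eq_smul_one (g : Mat q)).1 hs
  apply Units.ext
  rw [Units.val_mul, Units.val_mul, hc, Matrix.mul_smul, Matrix.mul_one, Matrix.smul_mul, Units.inv_mul]

/-- PROVED: for scalar `g ∈ S`, every `y` has `y⁻¹gy ∈ S`: the count is `|G|`. [folklore] -/
theorem card_conj_mem_of_isScalar (S : Finset (G q)) (g : G q) (hs : IsScalarMat (g : Mat q)) (hg : g ∈ S) :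
    (Finset.univ.filter fun y : G q => y⁻¹ * g * y ∈ S).card = Fintype.card (G q) := by
  rw [Finset.filter_true_of_mem (fun y _ => by rw [conj_of_isScalar g y hs]; exact hg), Finset.card_univ]

/-- PROVED: the centraliser of a REGULAR diagonal element is the split torus: `(q − 1)²` elements. [folklore] -/
theorem card_centralizer_diag (u : Fin 2 → (ZMod q)ˣ) (hu : u 0 ≠ u 1) :
    (Finset.univ.filter fun y : G q => y⁻¹ * diagGL u * y = diagGL u).card = (q - 1) ^ 2 := by
  rw [← splitTorus_card]
  congr 1
  ext y
  rw [Finset.mem_filter, mul_assoc, inv_mul_eq_iff_eq_mul, ← Units.val_inj, Units.val_mul, Units.val_mul, diagGL_coe]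
  simp only [Finset.mem_univ, true_and, splitTorus, Finset.mem_filter]
  have hu' : (u 0 : ZMod q) - (u 1 : ZMod q) ≠ 0 := sub_ne_zero.2 (fun h => hu (Units.ext h))
  constructor
  · intro h
    have h01 := congrFun (congrFun h 0) 1
    have h10 := congrFun (congrFun h 1) 0
    simp [Matrix.mul_apply, Matrix.diagonal] at h01 h10
    -- h01 : u0 * y01 = y01 * u1 ; h10 : u1 * y10 = y10 * u0
    constructor
    · have : ((u 0 : ZMod q) - (u 1 : ZMod q)) * (y : Mat q) 0 1 = 0 := by linear_combination h01
      exact (mul_eq_zero.1 this).resolve_left hu'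
    · have : ((u 0 : ZMod q) - (u 1 : ZMod q)) * (y : Mat q) 1 0 = 0 := by linear_combination -h10
      exact (mul_eq_zero.1 this).resolve_left hu'
  · rintro ⟨h01, h10⟩
    ext i j
    fin_cases i <;> fin_cases j <;> simp [Matrix.mul_apply, Matrix.diagonal, h01, h10] <;> ring

/-- PROVED: the centraliser of an element WITHOUT rational eigenvalue is its non-split torus: `q² − 1` elements (tree `nonsplitTorus_card`). [folklore] -/
theorem card_centralizer_of_not_hasRatEigenvalue (g : G q) (hg : ¬ HasRatEigenvalue (g : Mat q)) :
    (Finset.univ.filter fun y : G q => y⁻¹ * g * y = g).card = (q - 1) * (q + 1) := by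
  rw [← nonsplitTorus_card hg]
  congr 1
  ext y
  rw [Finset.mem_filter, mul_assoc, inv_mul_eq_iff_eq_mul, ← Units.val_inj, Units.val_mul, Units.val_mul]
  simp only [Finset.mem_univ, true_and, nonsplitTorus, Finset.mem_filter]
  exact eq_comm

end Summit.BirchSwinnertonDyer.BirchSwinnertonDyer.Theorems.CartanSupply.NormOne

end
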